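import Summits.Langlands.Langlands.Theorems.RationalPeriodQuarterRationalDescentPrelim

/-!
# `RationalDescent` — child 3 of the lens-1-g38 split of `RationalPeriodQuarter.SemiAnalyticRigidity`

Standalone proof of the statement of the child `RationalDescent` (decomp-langlands node `SemiAnalyticRigiditySplit`,
split of stmt-Langlands-2806), VERBATIM (same `let`s): if `f : ℝ → ℂ` is cofinitely piecewise rational with REAL
break points and COMPLEX coefficients, and all its weight-`−1` period coboundaries over `Γ₁(N)` are cofinitely in
`PR` (rational break points, rational denominators), then `f` is cofinitely in `PR`.

Proof (only the translation `T ∈ Γ₁(N)` is used).  TAILS: on `t > B` the function is one fraction `P₊/Q₊` whose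
coboundary is a `ℚ`-denominator fraction; the algebraic tail lemma (`ratDescent_rat_denominator`: poles walk right
into roots of the rational denominator, hence are algebraic; product of minimal polynomials) rewrites it with a
`ℚ[X]` denominator; same on the left tail.  MIDDLE: `f (t) = f (t+n) - ∑_{j<n} q_T (t+j)` cofinitely; for a rational
interval `(a,b)` avoiding `F := {±M} ∪ {r - j : r ∈ F_T, j ≤ n}` every `(a+j, b+j)` avoids `F_T`, so each
`q_T (t+j)` is one `ℚ`-denominator fraction there and `f (t+n)` is the tail fraction (piece lemma
`ratDescent_piece`).  The regularisation `q t := limUnder (𝓝[≠] t) f` is then that fraction at EVERY point of each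
piece and agrees with `f` cofinitely (`ratDescent_lim_piece`; finitely many pieces between consecutive points of
`F`).  Mathlib + the two preliminary files only.
-/

set_option linter.dupNamespace false

namespace Summit.Langlands.Langlands.Theorems

open Filter Set Topology Polynomial

/-- From the cofinite tail identities, the infinite set on which the rational-function coboundary identity holds
(right tail). -/
theorem ratDescent_tail_set_right (f ρ qT : ℝ → ℂ) (Bρ BT : ℝ) (Pp Qp PT : ℂ[X]) (DT : ℚ[X])
    (hρR : ∀ t : ℝ, Bρ < t → Qp.eval (t : ℂ) ≠ 0 ∧ ρ t = Pp.eval (t : ℂ) / Qp.eval (t : ℂ))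
    (hTR : ∀ x : ℝ, BT < x → aeval (x : ℂ) DT ≠ 0 ∧ qT x = PT.eval (x : ℂ) / aeval (x : ℂ) DT)
    (hfρ : ∀ᶠ t in Filter.cofinite, f t = ρ t) (hTf : ∀ᶠ t in Filter.cofinite, f (t + 1) - f t = qT t) :
    ∃ S : Set ℝ, S.Infinite ∧ ∀ t ∈ S, Qp.eval (t : ℂ) ≠ 0 ∧ Qp.eval ((t : ℂ) + 1) ≠ 0 ∧
      aeval (t : ℂ) DT ≠ 0 ∧ Pp.eval ((t : ℂ) + 1) / Qp.eval ((t : ℂ) + 1) - Pp.eval (t : ℂ) / Qp.eval (t : ℂ) =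
        PT.eval (t : ℂ) / aeval (t : ℂ) DT := by
  have hcof : ∀ᶠ t in Filter.cofinite, f t = ρ t ∧ f (t + 1) = ρ (t + 1) ∧ f (t + 1) - f t = qT t := by
    filter_upwards [hfρ, ratDescent_eventually_cofinite_shift hfρ 1, hTf] with t h1 h2 h3
    exact ⟨h1, h2, h3⟩
  refine ⟨Set.Ioi (max Bρ BT) \ {t | ¬ (f t = ρ t ∧ f (t + 1) = ρ (t + 1) ∧ f (t + 1) - f t = qT t)},
    (Set.Ioi_infinite _).sdiff (Filter.eventually_cofinite.1 hcof), fun t ht => ?_⟩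
  obtain ⟨hgt, hp⟩ := ht
  simp only [Set.mem_setOf_eq, not_not] at hp
  obtain ⟨h1, h2, h3⟩ := hp
  have hB : Bρ < t := lt_of_le_of_lt (le_max_left _ _) hgt
  have hB1 : Bρ < t + 1 := by linarith
  have hBT : BT < t := lt_of_le_of_lt (le_max_right _ _) hgt
  have e1 := hρR t hB
  have e2 := hρR (t + 1) hB1
  push_cast at e2
  refine ⟨e1.1, e2.1, (hTR t hBT).1, ?_⟩
  rw [← e2.2, ← e1.2, ← (hTR t hBT).2, ← h3, h1, h2]

/-- Same on the left tail. -/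
theorem ratDescent_tail_set_left (f ρ qT : ℝ → ℂ) (Bρ BT : ℝ) (Pm Qm PT : ℂ[X]) (DT : ℚ[X])
    (hρL : ∀ t : ℝ, t < -Bρ → Qm.eval (t : ℂ) ≠ 0 ∧ ρ t = Pm.eval (t : ℂ) / Qm.eval (t : ℂ))
    (hTL : ∀ x : ℝ, x < -BT → aeval (x : ℂ) DT ≠ 0 ∧ qT x = PT.eval (x : ℂ) / aeval (x : ℂ) DT)
    (hfρ : ∀ᶠ t in Filter.cofinite, f t = ρ t) (hTf : ∀ᶠ t in Filter.cofinite, f (t + 1) - f t = qT t) :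
    ∃ S : Set ℝ, S.Infinite ∧ ∀ t ∈ S, Qm.eval (t : ℂ) ≠ 0 ∧ Qm.eval ((t : ℂ) + 1) ≠ 0 ∧
      aeval (t : ℂ) DT ≠ 0 ∧ Pm.eval ((t : ℂ) + 1) / Qm.eval ((t : ℂ) + 1) - Pm.eval (t : ℂ) / Qm.eval (t : ℂ) =
        PT.eval (t : ℂ) / aeval (t : ℂ) DT := by
  have hcof : ∀ᶠ t in Filter.cofinite, f t = ρ t ∧ f (t + 1) = ρ (t + 1) ∧ f (t + 1) - f t = qT t := by
    filter_upwards [hfρ, ratDescent_eventually_cofinite_shift hfρ 1, hTf] with t h1 h2 h3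
    exact ⟨h1, h2, h3⟩
  refine ⟨Set.Iio (-(max Bρ BT) - 1) \ {t | ¬ (f t = ρ t ∧ f (t + 1) = ρ (t + 1) ∧ f (t + 1) - f t = qT t)},
    (Set.Iio_infinite _).sdiff (Filter.eventually_cofinite.1 hcof), fun t ht => ?_⟩
  obtain ⟨hlt, hp⟩ := ht
  simp only [Set.mem_setOf_eq, not_not] at hp
  obtain ⟨h1, h2, h3⟩ := hp
  have hlt' : t < -(max Bρ BT) - 1 := hlt
  have hm1 := le_max_left Bρ BT
  have hm2 := le_max_right Bρ BT
  have hB : t < -Bρ := by linarith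
  have hB1 : t + 1 < -Bρ := by linarith
  have hBT : t < -BT := by linarith
  have e1 := hρL t hB
  have e2 := hρL (t + 1) hB1
  push_cast at e2
  refine ⟨e1.1, e2.1, (hTL t hBT).1, ?_⟩
  rw [← e2.2, ← e1.2, ← (hTL t hBT).2, ← h3, h1, h2]

/-- MAIN THEOREM — the statement of the child `RationalDescent` of the lens-1-g38 split of
`RationalPeriodQuarter.SemiAnalyticRigidity` (stmt-Langlands-2806), verbatim (same `let`s). -/
theorem rationalDescent_statement :
    let slashHalf : Matrix.SpecialLinearGroup (Fin 2) ℤ → (ℝ → ℂ) → ℝ → ℂ := fun g φ t => ((|((g : Matrix (Fin 2) (Fin 2) ℤ) 1 0 : ℝ) * t + ((g : Matrix (Fin 2) (Fin 2) ℤ) 1 1 : ℝ)|⁻¹ : ℝ) : ℂ) * φ ((((g : Matrix (Fin 2) (Fin 2) ℤ) 0 0 : ℝ) * t + ((g : Matrix (Fin 2) (Fin 2) ℤ) 0 1 : ℝ)) / (((g : Matrix (Fin 2) (Fin 2) ℤ) 1 0 : ℝ) * t + ((g : Matrix (Fin 2) (Fin 2) ℤ) 1 1 : ℝ))); let IsPRC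 : (ℝ → ℂ) → Prop := fun φ => ∃ F : Finset ℚ, (∀ a b : ℚ, a < b → (∀ r ∈ F, r ≤ a ∨ b ≤ r) → ∃ (P : Polynomial ℂ) (Q : Polynomial ℚ), ∀ x : ℝ, (a : ℝ) < x → x < b → Polynomial.aeval (x : ℂ) Q ≠ 0 ∧ φ x = Polynomial.eval (x : ℂ) P / Polynomial.aeval (x : ℂ) Q) ∧ ∃ B : ℚ, (∃ (P : Polynomial ℂ) (Q : Polynomial ℚ), ∀ x : ℝ, (B : ℝ) < x → Polynomial.aeval (x : ℂ) Q ≠ 0 ∧ φ x = Polynomial.eval (x : ℂ) P / Polynomial.aeval (x : ℂ) Q) ∧ (∃ (P : Polynomial ℂ) (Q : Polynomial ℚ), ∀ x : ℝ, x < -(B : ℝ) → Polynomial.aeval (x : ℂ) Q ≠ 0 ∧ φ x = Polynomial.eval (x : ℂ) P / Polynomial.aeval (x : ℂ) Q); let IsPW : (ℝ → ℂ) → Prop := fun ρ => ∃ E : Finset ℝ, (∀ x : ℝ, x ∉ E → ∃ (P Q : Polynomial ℂ), ∀ᶠ (t : ℝ) in nhds x, Polynomial.eval (t : ℂ) Q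 ≠ 0 ∧ ρ t = Polynomial.eval (t : ℂ) P / Polynomial.eval (t : ℂ) Q) ∧ ∃ B : ℝ, (∃ (P Q : Polynomial ℂ), ∀ t : ℝ, B < t → Polynomial.eval (t : ℂ) Q ≠ 0 ∧ ρ t = Polynomial.eval (t : ℂ) P / Polynomial.eval (t : ℂ) Q) ∧ (∃ (P Q : Polynomial ℂ), ∀ t : ℝ, t < -B → Polynomial.eval (t : ℂ) Q ≠ 0 ∧ ρ t = Polynomial.eval (t : ℂ) P / Polynomial.eval (t : ℂ) Q); ∀ N : ℕ, 0 < N → ∀ f : ℝ → ℂ, (∃ ρ : ℝ → ℂ, IsPW ρ ∧ ∀ᶠ t in Filter.cofinite, f t = ρ t) → (∀ γ ∈ CongruenceSubgroup.Gamma1 N, ∃ q : ℝ → ℂ, IsPRC q ∧ ∀ᶠ t in Filter.cofinite, slashHalf γ f t - f t = q t) → ∃ q : ℝ → ℂ, IsPRC q ∧ ∀ᶠ t in Filter.cofinite, f t = q t := by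
  intro slashHalf IsPRC IsPW N hN f hPW hγ
  dsimp only [slashHalf, IsPRC, IsPW] at hPW hγ ⊢
  classical
  obtain ⟨ρ, ⟨-, -, Bρ, ⟨Pp, Qp, hρR⟩, ⟨Pm, Qm, hρL⟩⟩, hfρ⟩ := hPW
  -- the translation T ∈ Γ₁(N) and its coboundary qT
  let T : Matrix.SpecialLinearGroup (Fin 2) ℤ := ⟨!![1, 1; 0, 1], by norm_num [Matrix.det_fin_two_of]⟩
  have hT : T ∈ CongruenceSubgroup.Gamma1 N := by
    rw [CongruenceSubgroup.Gamma1_mem]; refine ⟨?_, ?_, ?_⟩ <;> simp [T]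
  obtain ⟨qT, ⟨FT, hTI, BT, ⟨PTp, DTp, hTR⟩, ⟨PTm, DTm, hTL⟩⟩, hTev⟩ := hγ T hT
  have hTf : ∀ᶠ t in Filter.cofinite, f (t + 1) - f t = qT t := by
    refine hTev.mono fun t ht => ?_
    have h00 : (((T : Matrix (Fin 2) (Fin 2) ℤ) 0 0 : ℤ) : ℝ) = 1 := by simp [T]
    have h01 : (((T : Matrix (Fin 2) (Fin 2) ℤ) 0 1 : ℤ) : ℝ) = 1 := by simp [T]
    have h10 : (((T : Matrix (Fin 2) (Fin 2) ℤ) 1 0 : ℤ) : ℝ) = 0 := by simp [T]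
    have h11 : (((T : Matrix (Fin 2) (Fin 2) ℤ) 1 1 : ℤ) : ℝ) = 1 := by simp [T]
    simp only [h00, h01, h10, h11, zero_mul, zero_add, abs_one, inv_one,
      Complex.ofReal_one, one_mul, div_one] at ht
    exact ht
  -- nonvanishing polynomials
  have hQp : Qp ≠ 0 := by
    intro h0; have := (hρR (Bρ + 1) (by linarith)).1; simp [h0] at this
  have hQm : Qm ≠ 0 := by
    intro h0; have := (hρL (-Bρ - 1) (by linarith)).1; simp [h0] at this
  have hDTp : DTp ≠ 0 := by
    intro h0; have := (hTR ((BT : ℝ) + 1) (by linarith)).1; simp [h0] at this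
  have hDTm : DTm ≠ 0 := by
    intro h0; have := (hTL (-(BT : ℝ) - 1) (by linarith)).1; simp [h0] at this
  -- RIGHT TAIL with a rational denominator
  obtain ⟨SR, hSRinf, hSR⟩ := ratDescent_tail_set_right f ρ qT Bρ BT Pp Qp PTp DTp hρR hTR hfρ hTf
  obtain ⟨P₂, D, hD, hrep⟩ := ratDescent_rat_denominator Pp Qp PTp DTp hQp hDTp SR hSRinf hSR
  obtain ⟨R, hR⟩ := ratDescent_exists_bound_aeval_ne_zero D hD
  have hgoodR : ∀ t : ℝ, max Bρ R < t → aeval (t : ℂ) D ≠ 0 := fun t ht =>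
    hR t (Or.inl (lt_of_le_of_lt (le_max_right _ _) ht))
  have hbaseR : ∀ᶠ t in Filter.cofinite, max Bρ R < t → f t = P₂.eval (t : ℂ) / aeval (t : ℂ) D := by
    filter_upwards [hfρ] with t ht hlt
    have hB : Bρ < t := lt_of_le_of_lt (le_max_left _ _) hlt
    rw [ht, (hρR t hB).2]
    exact hrep (t : ℂ) (hgoodR t hlt) (hρR t hB).1
  -- LEFT TAIL with a rational denominator
  obtain ⟨SL, hSLinf, hSL⟩ := ratDescent_tail_set_left f ρ qT Bρ BT Pm Qm PTm DTm hρL hTL hfρ hTf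
  obtain ⟨P₂', D', hD', hrep'⟩ := ratDescent_rat_denominator Pm Qm PTm DTm hQm hDTm SL hSLinf hSL
  obtain ⟨R', hR'⟩ := ratDescent_exists_bound_aeval_ne_zero D' hD'
  have hgoodL : ∀ t : ℝ, t < -(max Bρ R') → aeval (t : ℂ) D' ≠ 0 := fun t ht =>
    hR' t (Or.inr (by have := le_max_right Bρ R'; linarith))
  have hbaseL : ∀ᶠ t in Filter.cofinite, t < -(max Bρ R') → f t = P₂'.eval (t : ℂ) / aeval (t : ℂ) D' := by
    filter_upwards [hfρ] with t ht hlt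
    have hB : t < -Bρ := by have := le_max_left Bρ R'; linarith
    rw [ht, (hρL t hB).2]
    exact hrep' (t : ℂ) (hgoodL t hlt) (hρL t hB).1
  -- the rational bound M and the number of steps n
  obtain ⟨M, hM⟩ := exists_rat_gt (max (max Bρ R) (max Bρ R'))
  have hMR : max Bρ R < M := lt_of_le_of_lt (le_max_left _ _) hM
  have hML : max Bρ R' < M := lt_of_le_of_lt (le_max_right _ _) hM
  obtain ⟨n, hn⟩ := exists_nat_gt ((M : ℝ) + max Bρ R)
  -- the rational break set
  obtain ⟨F, hF⟩ : ∃ F : Finset ℚ,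
      F = {M, -M} ∪ (FT ×ˢ Finset.range (n + 1)).image (fun p => p.1 - (p.2 : ℚ)) := ⟨_, rfl⟩
  have hMF : M ∈ F := by rw [hF]; simp
  have hMF' : -M ∈ F := by rw [hF]; simp
  have hFT : ∀ r ∈ FT, ∀ j : ℕ, j < n + 1 → r - (j : ℚ) ∈ F := by
    intro r hr j hj
    rw [hF, Finset.mem_union, Finset.mem_image]
    exact Or.inr ⟨(r, j), Finset.mem_product.2 ⟨hr, Finset.mem_range.2 hj⟩, rfl⟩
  -- the three kinds of pieces for q := punctured-limit regularisation of f
  -- (1) right tail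
  obtain ⟨PR, DR, hDR, hfR⟩ := ratDescent_piece f qT (Set.Ioi (M : ℝ)) (fun t => max Bρ R < t) 0 P₂ D
    hgoodR hbaseR (fun t ht => by simpa using lt_trans hMR ht) hTf (fun _ => 0) (fun _ => 1)
    (fun j hj => absurd hj (Nat.not_lt_zero j))
  obtain ⟨hqR, hfqR⟩ := ratDescent_lim_piece f _ isOpen_Ioi PR DR hDR hfR
  -- (2) left tail
  obtain ⟨PL, DL, hDL, hfL⟩ := ratDescent_piece f qT (Set.Iio (-(M : ℝ))) (fun t => t < -(max Bρ R')) 0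
    P₂' D' hgoodL hbaseL (fun t ht => by simp only [Set.mem_Iio] at ht; simpa using by linarith)
    hTf (fun _ => 0) (fun _ => 1) (fun j hj => absurd hj (Nat.not_lt_zero j))
  obtain ⟨hqL, hfqL⟩ := ratDescent_lim_piece f _ isOpen_Iio PL DL hDL hfL
  -- (3) middle pieces
  have hmid : ∀ a b : ℚ, a < b → -M ≤ a → b ≤ M → (∀ r ∈ F, r ≤ a ∨ b ≤ r) →
      ∃ (P : ℂ[X]) (Dt : ℚ[X]), (∀ x ∈ Set.Ioo (a : ℝ) b, aeval (x : ℂ) Dt ≠ 0 ∧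
        limUnder (𝓝[≠] x) f = P.eval (x : ℂ) / aeval (x : ℂ) Dt) ∧
        ∀ᶠ t in Filter.cofinite, t ∈ Set.Ioo (a : ℝ) b → f t = limUnder (𝓝[≠] t) f := by
    intro a b hab ha hb havoid
    have hpieces : ∀ j : ℕ, ∃ (P : ℂ[X]) (Dq : ℚ[X]), j < n → ∀ x : ℝ, (a : ℝ) + j < x → x < (b : ℝ) + j →
        aeval (x : ℂ) Dq ≠ 0 ∧ qT x = P.eval (x : ℂ) / aeval (x : ℂ) Dq := by
      intro j
      by_cases hjn : j < n
      · have hav : ∀ r ∈ FT, r ≤ a + j ∨ b + j ≤ r := by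
          intro r hr
          rcases havoid (r - j) (hFT r hr j (by omega)) with h | h
          · left; linarith
          · right; linarith
        obtain ⟨P, Dq, h⟩ := hTI (a + j) (b + j) (by linarith) hav
        refine ⟨P, Dq, fun _ x hx1 hx2 => h x ?_ ?_⟩
        · push_cast; exact hx1
        · push_cast; exact hx2
      · exact ⟨0, 1, fun h => absurd h hjn⟩
    choose Pj Dj hPj using hpieces
    obtain ⟨P, Dt, hDt, hfP⟩ := ratDescent_piece f qT (Set.Ioo (a : ℝ) b) (fun t => max Bρ R < t) n P₂ D
      hgoodR hbaseR (fun t ht => by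
        have h1 := ht.1; have h2 : ((-M : ℚ) : ℝ) ≤ a := by exact_mod_cast ha
        push_cast at hn h2 ⊢; linarith) hTf Pj Dj
      (fun j hj t ht => by
        have h := hPj j hj (t + j) (by have := ht.1; linarith) (by have := ht.2; linarith)
        push_cast at h
        exact h)
    obtain ⟨hq, hfq⟩ := ratDescent_lim_piece f _ isOpen_Ioo P Dt hDt hfP
    exact ⟨P, Dt, fun x hx => ⟨hDt x hx, hq x hx⟩, hfq⟩
  -- ASSEMBLY
  refine ⟨fun t => limUnder (𝓝[≠] t) f, ⟨F, ?_, M, ⟨PR, DR, fun x hx => ⟨hDR x hx, hqR x hx⟩⟩,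
    ⟨PL, DL, fun x hx => ⟨hDL x hx, hqL x hx⟩⟩⟩, ?_⟩
  · -- interval clause
    intro a b hab havoid
    rcases havoid M hMF with h1 | h1
    · -- M ≤ a : inside the right tail
      refine ⟨PR, DR, fun x hx1 hx2 => ?_⟩
      have hx : x ∈ Set.Ioi (M : ℝ) := by
        simp only [Set.mem_Ioi]; exact lt_of_le_of_lt (by exact_mod_cast h1) hx1
      exact ⟨hDR x hx, hqR x hx⟩
    · rcases havoid (-M) hMF' with h2 | h2
      · -- middle
        obtain ⟨P, Dt, h, -⟩ := hmid a b hab h2 h1 havoid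
        exact ⟨P, Dt, fun x hx1 hx2 => h x ⟨hx1, hx2⟩⟩
      · -- b ≤ -M : inside the left tail
        refine ⟨PL, DL, fun x hx1 hx2 => ?_⟩
        have hx : x ∈ Set.Iio (-(M : ℝ)) := by
          simp only [Set.mem_Iio]; exact lt_of_lt_of_le hx2 (by exact_mod_cast h2)
        exact ⟨hDL x hx, hqL x hx⟩
  · -- cofinite agreement
    have hpairs : ∀ p ∈ (F ×ˢ F).filter (fun p => p.1 < p.2 ∧ -M ≤ p.1 ∧ p.2 ≤ M ∧
        ∀ r ∈ F, r ≤ p.1 ∨ p.2 ≤ r), ∀ᶠ t in Filter.cofinite,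
        t ∈ Set.Ioo (p.1 : ℝ) p.2 → f t = limUnder (𝓝[≠] t) f := by
      intro p hp
      obtain ⟨-, h1, h2, h3, h4⟩ := Finset.mem_filter.1 hp
      obtain ⟨-, -, -, h⟩ := hmid p.1 p.2 h1 h2 h3 h4
      exact h
    have hnotF : ∀ᶠ t : ℝ in Filter.cofinite, t ∉ F.image (fun r : ℚ => (r : ℝ)) := by
      refine Filter.eventually_cofinite.2 ?_
      simp only [not_not, Finset.setOf_mem]
      exact Finset.finite_toSet _
    filter_upwards [hfqR, hfqL, (Filter.eventually_all_finset _).2 hpairs, hnotF] with t hR hL hmd hnF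
    by_cases htR : (M : ℝ) < t
    · exact hR htR
    by_cases htL : t < -(M : ℝ)
    · exact hL htL
    push Not at htR htL
    have hne : ∀ r ∈ F, (r : ℝ) ≠ t := by
      intro r hr h; exact hnF (Finset.mem_image.2 ⟨r, hr, h⟩)
    have htM : t < M := lt_of_le_of_ne htR (fun h => hne M hMF h.symm)
    have htM' : -(M : ℝ) < t := lt_of_le_of_ne htL (fun h => hne (-M) hMF' (by push_cast; exact h))
    have hneA : (F.filter (fun r : ℚ => (↑r : ℝ) < t)).Nonempty := ⟨-M, Finset.mem_filter.2 ⟨hMF', by push_cast; exact htM'⟩⟩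
    have hneB : (F.filter (fun r : ℚ => t < (↑r : ℝ))).Nonempty := ⟨M, Finset.mem_filter.2 ⟨hMF, htM⟩⟩
    obtain ⟨a₀, ha₀⟩ : ∃ a₀, a₀ = (F.filter (fun r : ℚ => (↑r : ℝ) < t)).max' hneA := ⟨_, rfl⟩
    obtain ⟨b₀, hb₀⟩ : ∃ b₀, b₀ = (F.filter (fun r : ℚ => t < (↑r : ℝ))).min' hneB := ⟨_, rfl⟩
    have ha₀mem : a₀ ∈ F.filter (fun r : ℚ => (↑r : ℝ) < t) := ha₀ ▸ Finset.max'_mem _ _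
    have hb₀mem : b₀ ∈ F.filter (fun r : ℚ => t < (↑r : ℝ)) := hb₀ ▸ Finset.min'_mem _ _
    have ha₀t : (a₀ : ℝ) < t := (Finset.mem_filter.1 ha₀mem).2
    have hb₀t : t < (b₀ : ℝ) := (Finset.mem_filter.1 hb₀mem).2
    have hpmem : (a₀, b₀) ∈ (F ×ˢ F).filter (fun p => p.1 < p.2 ∧ -M ≤ p.1 ∧ p.2 ≤ M ∧
        ∀ r ∈ F, r ≤ p.1 ∨ p.2 ≤ r) := by
      refine Finset.mem_filter.2 ⟨Finset.mem_product.2 ⟨(Finset.mem_filter.1 ha₀mem).1,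
        (Finset.mem_filter.1 hb₀mem).1⟩, ?_, ?_, ?_, ?_⟩
      · exact_mod_cast ha₀t.trans hb₀t
      · rw [ha₀]; exact Finset.le_max' _ _ (Finset.mem_filter.2 ⟨hMF', by push_cast; exact htM'⟩)
      · rw [hb₀]; exact Finset.min'_le _ _ (Finset.mem_filter.2 ⟨hMF, htM⟩)
      · intro r hr
        rcases lt_trichotomy (r : ℝ) t with h | h | h
        · left; rw [ha₀]; exact Finset.le_max' _ _ (Finset.mem_filter.2 ⟨hr, h⟩)
        · exact absurd h (hne r hr)
        · right; rw [hb₀]; exact Finset.min'_le _ _ (Finset.mem_filter.2 ⟨hr, h⟩)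
    exact hmd (a₀, b₀) hpmem ⟨ha₀t, hb₀t⟩

end Summit.Langlands.Langlands.Theorems
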